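/-
Copyright: lead seat `ym-line-sll-p1` (prover-ym-line-sll-p1-g0-0), route `SoftLoopLongLag`, cruxes `ColdBoxSoftLoopLagFloor`
(stmt-QuantumFields-22503; stubs S2a/S2b) and `SoftLoopLagFloorToTorus` (stmt-QuantumFields-22504; stubs K2/K3).
-/
import Summits.QuantumFields.YangMills.Theorems.ColdBoxAllGroupsBoxFloorAllGroupsCubicG
import Summits.QuantumFields.BalabanUV.Beta.EriceAxialGaugeWords

/-!
# The Wilson LOOP cost in the exponential chart of a compact group presented in `U(N)`: cubic remainder for a product of ANY number
# of small exponentials — `|(N − Re tr Π e^{A_k}) − ½‖Σ A_k‖_F²| ≤ 9·t³`, `t = Σ‖A_k‖_F ≤ 1/4`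

The loop (list) counterpart of the plaquette brick `ColdBoxAllGroupsBoxFloorAllGroupsCubicG` (four factors, constant `190 m³` with `m` the
maximal link size): here the bound is in the PERIMETER SUM `t = Σ_k ‖A_k‖_F`, which is what an `R×R` loop of `4R` links needs.

* §1 (any complete normed algebra) `norm_list_prod_one_add_sub_le` — `‖Π_k (1 + Y_k) − 1 − Σ_k Y_k‖ ≤ e^{s} − 1 − s`, `s = Σ‖Y_k‖`
  (induction on the list; `(1+y)e^{s} ≤ e^{y+s}`); `norm_list_prod_exp_sub_one_sub_sum_le` — `‖Π_k e^{A_k} − 1 − Σ_k A_k‖ ≤ 5t²` for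
  `t = Σ‖A_k‖ ≤ 1/4` (with the tree's `‖e^X − 1‖ ≤ (3/2)‖X‖`, `‖e^X − 1 − X‖ ≤ 2‖X‖²`).
* §2 (`M_N(ℂ)`, Frobenius, skew-Hermitian `A_k`) `abs_cost_list_prod_exp_sub_half_norm_sq_le` —
  `|(N − Re tr Π_k e^{A_k}) − ½‖Σ_k A_k‖_F²| ≤ 9t³` (the product is unitary and `N − Re tr U = ½‖U − 1‖_F²`, tree
  `sub_re_trace_eq_half_norm_sub_one_sq`).  Backward links: `(e^{A})⁻¹ = e^{−A}` and `−A` is skew-Hermitian with the same norm, so a signed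
  product is a product of this form.
* §3 (the chart `expChart ρ`) `abs_cost_expChart_listProd_sub_half_norm_sq_le` — for chart coordinates `a_k ∈ ℝ^D` with `t = Σ‖a_k‖ ≤ 1/4`:
  `|(N − Re tr Π_k e^{lieIso ρ a_k}) − ½‖Σ_k a_k‖²| ≤ 9t³` (`lieIso ρ` a linear isometry onto skew-Hermitian matrices,
  `ρ(expChart ρ a) = e^{lieIso ρ a}`).  With `walkHolonomy U w = (w.darts.map (dartHolonomy U)).prod` this says the normalised loop character is
  `1 − ‖Σ_k σ_k a_k‖²/(2N) + O(t³/N)`: the ABELIANISED (lattice-Stokes) leading order of the soft-loop observable used by the T′/K′ lines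
  (cards `Cruxes/ColdBoxSoftLoopLagFloor/Lines/birth.md`, `Cruxes/SoftLoopLagFloorToTorus/Lines/birth.md`).

Everything is proved; no definition, no named fact; standard axioms.  HONEST LABEL: rung-level support (R2xi-G, RECORD label, an UPPER bound
on the lattice mass gap); NOT the Clay mass gap.
-/

set_option autoImplicit false

noncomputable section

open scoped Matrix Matrix.Norms.Frobenius
open NormedSpace
open Summit.QuantumFields.BalabanUV.Beta.EriceAxialGaugeWords (sum_map_norm_nonneg norm_list_sum_le)

namespace Summit.QuantumFields.YangMills.Theorems.SoftLoopLongLag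

/-! ## §1 Products of many small factors in a complete normed algebra -/

section Banach

variable {𝔸 : Type*} [NormedRing 𝔸] [NormedAlgebra ℝ 𝔸] [CompleteSpace 𝔸]

omit [NormedAlgebra ℝ 𝔸] [CompleteSpace 𝔸] in
/-- Each norm is at most the norm sum. -/
theorem norm_le_list_sum_norm {l : List 𝔸} {A : 𝔸} (hA : A ∈ l) : ‖A‖ ≤ (l.map (‖·‖)).sum :=
  List.single_le_sum (fun x hx => by obtain ⟨y, -, rfl⟩ := List.mem_map.1 hx; exact norm_nonneg _) _ (List.mem_map_of_mem hA)

omit [NormedAlgebra ℝ 𝔸] [CompleteSpace 𝔸] in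
/-- **First-order expansion of a finite product**: `‖Π_k (1 + Y_k) − 1 − Σ_k Y_k‖ ≤ e^{s} − 1 − s` with `s = Σ_k ‖Y_k‖`. -/
theorem norm_list_prod_one_add_sub_le (l : List 𝔸) :
    ‖(l.map fun Y => 1 + Y).prod - 1 - l.sum‖ ≤ Real.exp (l.map (‖·‖)).sum - 1 - (l.map (‖·‖)).sum := by
  induction l with
  | nil => simp
  | cons Y l ih =>
    simp only [List.map_cons, List.prod_cons, List.sum_cons]
    set P := (l.map fun Y => 1 + Y).prod with hP
    set T := l.sum with hT
    set s := (l.map (‖·‖)).sum with hs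
    have hTs : ‖T‖ ≤ s := by rw [hT, hs]; exact norm_list_sum_le l
    -- `(1+Y)P − 1 − (Y + T) = (P − 1 − T) + Y(P − 1 − T) + Y T`
    have e : (1 + Y) * P - 1 - (Y + T) = (P - 1 - T) + Y * (P - 1 - T) + Y * T := by noncomm_ring
    rw [e]
    have h1 : ‖Y * (P - 1 - T)‖ ≤ ‖Y‖ * (Real.exp s - 1 - s) :=
      (norm_mul_le _ _).trans (mul_le_mul_of_nonneg_left ih (norm_nonneg _))
    have h2 : ‖Y * T‖ ≤ ‖Y‖ * s := (norm_mul_le _ _).trans (mul_le_mul_of_nonneg_left hTs (norm_nonneg _))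
    have key : (Real.exp s - 1 - s) + ‖Y‖ * (Real.exp s - 1 - s) + ‖Y‖ * s ≤ Real.exp (‖Y‖ + s) - 1 - (‖Y‖ + s) := by
      rw [Real.exp_add]
      have hY := Real.add_one_le_exp ‖Y‖
      have hes : 0 < Real.exp s := Real.exp_pos s
      nlinarith [mul_le_mul_of_nonneg_right hY hes.le, norm_nonneg Y]
    calc ‖P - 1 - T + Y * (P - 1 - T) + Y * T‖ ≤ ‖P - 1 - T‖ + ‖Y * (P - 1 - T)‖ + ‖Y * T‖ := norm_add₃_le
      _ ≤ (Real.exp s - 1 - s) + ‖Y‖ * (Real.exp s - 1 - s) + ‖Y‖ * s := by linarith [ih]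
      _ ≤ _ := key

/-- The elementary estimate `e^u − 1 − u ≤ u²` on `[0, 1/2]`. -/
theorem exp_sub_one_sub_le_sq {u : ℝ} (hu0 : 0 ≤ u) (hu : u ≤ 1 / 2) : Real.exp u - 1 - u ≤ u ^ 2 := by
  have := Real.abs_exp_sub_one_sub_id_le (x := u) (by rw [abs_of_nonneg hu0]; linarith)
  rw [abs_le] at this
  linarith [this.2]

/-- **First-order expansion of a product of exponentials in the perimeter sum**: for `t = Σ_k ‖A_k‖ ≤ 1/4`,
`‖Π_k e^{A_k} − 1 − Σ_k A_k‖ ≤ 5t²`. -/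
theorem norm_list_prod_exp_sub_one_sub_sum_le (l : List 𝔸) (ht : (l.map (‖·‖)).sum ≤ 1 / 4) :
    ‖(l.map exp).prod - 1 - l.sum‖ ≤ 5 * (l.map (‖·‖)).sum ^ 2 := by
  set t := (l.map (‖·‖)).sum with htdef
  have ht0 : 0 ≤ t := sum_map_norm_nonneg l
  -- `Y_k = e^{A_k} − 1`
  set lY : List 𝔸 := l.map fun A => exp A - 1 with hlY
  have hprod : (l.map exp).prod = (lY.map fun Y => 1 + Y).prod := by
    rw [hlY, List.map_map]
    exact congrArg List.prod (List.map_congr_left fun A _ => by simp)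
  -- `Σ ‖Y_k‖ ≤ (3/2) t`
  have hsY : (lY.map (‖·‖)).sum ≤ 3 / 2 * t := by
    rw [hlY, List.map_map, htdef, ← List.sum_map_mul_left]
    exact List.sum_le_sum fun A hA =>
      ColdBoxAllGroups.norm_exp_sub_one_le' ((norm_le_list_sum_norm hA).trans ht)
  -- `Σ_k (Y_k − A_k)` has norm `≤ 2 Σ ‖A_k‖² ≤ 2 t²`
  have hsum_split : lY.sum = l.sum + (l.map fun A => exp A - 1 - A).sum := by
    rw [hlY]
    clear hprod hsY hlY ht htdef ht0
    induction l with
    | nil => simp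
    | cons A l ih =>
      simp only [List.map_cons, List.sum_cons] at ih ⊢
      rw [ih]; abel
  have hR : ‖(l.map fun A => exp A - 1 - A).sum‖ ≤ 2 * t ^ 2 := by
    refine (norm_list_sum_le _).trans ?_
    rw [List.map_map]
    have hpt : ∀ A ∈ l, ‖exp A - 1 - A‖ ≤ (2 * t) * ‖A‖ := fun A hA => by
      have hAt : ‖A‖ ≤ t := norm_le_list_sum_norm hA
      have h := ColdBoxAllGroups.norm_exp_sub_one_sub_le (X := A) (hAt.trans (ht.trans (by norm_num)))
      calc ‖exp A - 1 - A‖ ≤ 2 * ‖A‖ ^ 2 := h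
        _ = (2 * ‖A‖) * ‖A‖ := by ring
        _ ≤ (2 * t) * ‖A‖ := mul_le_mul_of_nonneg_right (by linarith) (norm_nonneg _)
    calc (l.map (Function.comp (‖·‖) fun A => exp A - 1 - A)).sum ≤ (l.map fun A => (2 * t) * ‖A‖).sum :=
          List.sum_le_sum fun A hA => hpt A hA
      _ = 2 * t * t := by rw [List.sum_map_mul_left, ← htdef]
      _ = 2 * t ^ 2 := by ring
  -- assemble
  have hmain := norm_list_prod_one_add_sub_le lY
  have hφ : Real.exp (lY.map (‖·‖)).sum - 1 - (lY.map (‖·‖)).sum ≤ (3 / 2 * t) ^ 2 := by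
    have hmono : Real.exp (lY.map (‖·‖)).sum - 1 - (lY.map (‖·‖)).sum ≤ Real.exp (3 / 2 * t) - 1 - 3 / 2 * t := by
      -- `u ↦ e^u − 1 − u` is monotone on `[0, ∞)`
      have h0 : 0 ≤ (lY.map (‖·‖)).sum := sum_map_norm_nonneg lY
      have hd : Real.exp (lY.map (‖·‖)).sum ≤ Real.exp (3 / 2 * t) := Real.exp_le_exp.2 hsY
      have hconv := Real.add_one_le_exp ((lY.map (‖·‖)).sum)
      -- `e^b − e^a ≥ (b − a)` for `0 ≤ a ≤ b` (mean value with `e^a ≥ 1`)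
      have hmv : (3 / 2 * t - (lY.map (‖·‖)).sum) ≤ Real.exp (3 / 2 * t) - Real.exp (lY.map (‖·‖)).sum := by
        have := Real.add_one_le_exp (3 / 2 * t - (lY.map (‖·‖)).sum)
        have hea : 1 ≤ Real.exp (lY.map (‖·‖)).sum := Real.one_le_exp h0
        have heq : Real.exp (3 / 2 * t) = Real.exp (lY.map (‖·‖)).sum * Real.exp (3 / 2 * t - (lY.map (‖·‖)).sum) := by
          rw [← Real.exp_add]; ring_nf
        rw [heq]
        nlinarith [Real.exp_pos (3 / 2 * t - (lY.map (‖·‖)).sum)]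
      linarith
    exact hmono.trans (exp_sub_one_sub_le_sq (by positivity) (by linarith))
  have e : (l.map exp).prod - 1 - l.sum =
      ((lY.map fun Y => 1 + Y).prod - 1 - lY.sum) + (l.map fun A => exp A - 1 - A).sum := by
    rw [hprod, hsum_split]; abel
  rw [e]
  calc ‖((lY.map fun Y => 1 + Y).prod - 1 - lY.sum) + (l.map fun A => exp A - 1 - A).sum‖
      ≤ ‖(lY.map fun Y => 1 + Y).prod - 1 - lY.sum‖ + ‖(l.map fun A => exp A - 1 - A).sum‖ := norm_add_le _ _
    _ ≤ (3 / 2 * t) ^ 2 + 2 * t ^ 2 := add_le_add (hmain.trans hφ) hR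
    _ ≤ 5 * t ^ 2 := by nlinarith

end Banach

/-! ## §2 The loop cost of a product of exponentials of skew-Hermitian matrices -/

section Matrices

variable {N : ℕ}

/-- Scalar step: `|½‖s + E‖² − ½‖s‖²| ≤ ‖s‖·‖E‖ + ½‖E‖²`. -/
theorem abs_half_norm_sq_add_sub_le {E' : Type*} [SeminormedAddCommGroup E'] (s E : E') :
    |‖s + E‖ ^ 2 / 2 - ‖s‖ ^ 2 / 2| ≤ ‖s‖ * ‖E‖ + ‖E‖ ^ 2 / 2 := by
  have h1 : ‖s + E‖ ≤ ‖s‖ + ‖E‖ := norm_add_le _ _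
  have h2 : ‖s‖ ≤ ‖s + E‖ + ‖E‖ := by
    have := norm_sub_le (s + E) E; rwa [add_sub_cancel_right] at this
  have hs0 := norm_nonneg s
  have hE0 := norm_nonneg E
  have hsE0 := norm_nonneg (s + E)
  rw [abs_le]
  constructor <;> nlinarith

/-- A product of exponentials of skew-Hermitian matrices is unitary. -/
theorem list_prod_exp_mem_unitaryGroup (l : List (Matrix (Fin N) (Fin N) ℂ)) (hskew : ∀ A ∈ l, Aᴴ = -A) :
    (l.map exp).prod ∈ Matrix.unitaryGroup (Fin N) ℂ := by
  refine list_prod_mem fun U hU => ?_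
  obtain ⟨A, hA, rfl⟩ := List.mem_map.1 hU
  exact FreeEnergyLogCoefficient.exp_mem_unitaryGroup_of_skew (hskew A hA)

/-- **Cubic remainder of the LOOP cost in exponential coordinates** (matrix form): for skew-Hermitian `A_1, …, A_m` with perimeter sum
`t = Σ_k ‖A_k‖_F ≤ 1/4`, `|(N − Re tr Π_k e^{A_k}) − ½‖Σ_k A_k‖_F²| ≤ 9·t³`. -/
theorem abs_cost_list_prod_exp_sub_half_norm_sq_le (l : List (Matrix (Fin N) (Fin N) ℂ)) (hskew : ∀ A ∈ l, Aᴴ = -A)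
    (ht : (l.map (‖·‖)).sum ≤ 1 / 4) :
    |((N : ℝ) - ((l.map exp).prod).trace.re) - ‖l.sum‖ ^ 2 / 2| ≤ 9 * (l.map (‖·‖)).sum ^ 3 := by
  set t := (l.map (‖·‖)).sum with htdef
  have ht0 : 0 ≤ t := sum_map_norm_nonneg l
  rw [Literature.MathematicalPhysics.QuantumFieldTheory.sub_re_trace_eq_half_norm_sub_one_sq (list_prod_exp_mem_unitaryGroup l hskew)]
  set s := l.sum with hs
  set E := (l.map exp).prod - 1 - s with hE
  have hEs : (l.map exp).prod - 1 = s + E := by rw [hE]; abel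
  have hEle : ‖E‖ ≤ 5 * t ^ 2 := norm_list_prod_exp_sub_one_sub_sum_le l ht
  have hsle : ‖s‖ ≤ t := by rw [hs, htdef]; exact norm_list_sum_le l
  rw [hEs]
  refine (abs_half_norm_sq_add_sub_le s E).trans ?_
  have hE0 := norm_nonneg E
  have h1 : ‖s‖ * ‖E‖ ≤ t * (5 * t ^ 2) := mul_le_mul hsle hEle hE0 ht0
  have h2 : ‖E‖ ^ 2 / 2 ≤ (5 * t ^ 2) ^ 2 / 2 := by
    have := pow_le_pow_left₀ hE0 hEle 2; linarith
  have h3 : (5 * t ^ 2) ^ 2 / 2 ≤ 4 * t ^ 3 := by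
    have : t ^ 4 ≤ t ^ 3 * (1 / 4) := by
      rw [show t ^ 4 = t ^ 3 * t by ring]; exact mul_le_mul_of_nonneg_left ht (by positivity)
    nlinarith
  nlinarith

/-- Backward links: `e^{−A}` for skew-Hermitian `A` is again of the form `e^{A'}`, `A'` skew-Hermitian with `‖A'‖ = ‖A‖` — so a SIGNED product
`Π_k (e^{A_k})^{σ_k}` is `Π_k e^{σ_k A_k}` (`(e^{A})⁻¹ = e^{−A}`, tree `inv_exp_eq_exp_neg`).  This lemma records the sign bookkeeping:
negation preserves skew-Hermitianness. -/
theorem conjTranspose_neg_of_skew {A : Matrix (Fin N) (Fin N) ℂ} (hA : Aᴴ = -A) : (-A)ᴴ = -(-A) := by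
  rw [Matrix.conjTranspose_neg, hA]

end Matrices

/-! ## §3 The loop cost in the exponential chart `expChart ρ` -/

section Chart

open Summit.QuantumFields.YangMills.Theorems.FreeEnergyLogCoefficient

variable {N : ℕ} {G : Type*} [Group G] (ρ : G →* Matrix (Fin N) (Fin N) ℂ)

/-- **Cubic remainder of the LOOP cost in the exponential chart.**  For a continuous unitary-valued `ρ : G →* U(N)` and chart coordinates
`a_1, …, a_m ∈ ℝ^D` (`D = dimE ρ`) with perimeter sum `t = Σ_k ‖a_k‖ ≤ 1/4`:
`|(N − Re tr Π_k e^{lieIso ρ a_k}) − ½‖Σ_k a_k‖²| ≤ 9·t³` — the loop Wilson cost is the half squared Euclidean norm of the LINEAR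
circulation of the chart coordinates up to a cubic remainder in the perimeter sum (signed links: replace `a_k` by `−a_k`). -/
theorem abs_cost_expChart_listProd_sub_half_norm_sq_le (l : List (EuclideanSpace ℝ (Fin (dimE ρ))))
    (ht : (l.map (‖·‖)).sum ≤ 1 / 4) :
    |((N : ℝ) - ((l.map fun a => exp (lieIso ρ a)).prod).trace.re) - ‖l.sum‖ ^ 2 / 2| ≤ 9 * (l.map (‖·‖)).sum ^ 3 := by
  -- pass to the list of skew-Hermitian matrices `lieIso ρ a_k`
  set lA : List (Matrix (Fin N) (Fin N) ℂ) := l.map (lieIso ρ) with hlA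
  have hprod : (l.map fun a => exp (lieIso ρ a)).prod = (lA.map exp).prod := by rw [hlA, List.map_map]; rfl
  have hskew : ∀ A ∈ lA, Aᴴ = -A := fun A hA => by
    obtain ⟨a, -, rfl⟩ := List.mem_map.1 hA
    exact conjTranspose_lieIso ρ a
  have hnorms : (lA.map (‖·‖)).sum = (l.map (‖·‖)).sum := by
    rw [hlA, List.map_map]
    exact congrArg List.sum (List.map_congr_left fun a _ => by simp)
  have hsum : ‖l.sum‖ = ‖lA.sum‖ := by
    rw [hlA, ← map_list_sum, norm_lieIso]
  rw [hprod, hsum, ← hnorms]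
  exact abs_cost_list_prod_exp_sub_half_norm_sq_le lA hskew (hnorms ▸ ht)

end Chart

end Summit.QuantumFields.YangMills.Theorems.SoftLoopLongLag

end
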